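import Literature.Computability.Complexity.GraphCanonizationMachine
import Literature.Computability.Complexity.GraphCanonizationSchemeCorrect
import Literature.Computability.Complexity.GraphCanonizationSchemeSize
import Literature.Computability.Complexity.GraphCanonizationProgramParts
import HarnessLib

/-!
# The canoniser as a list program, IV: the stack machine on lists

The stack machine of `GraphCanonizationMachine.lean` (`CGCanon.Frame`, `classify`, `step`, `run`)
with every frame written as list data (`CGProg.LFrame`: masks, colour lists, vertex numerals),
the form a string program manipulates:

* `CGProg.LFrame`, `classifyL`, `bestOfL`, `pkeyL`, `pasteL`, `stepL`, `runL` — the same case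
  analysis on the same keys (the keys ARE elements of the same linear orders `CGCanon.Code`,
  `Lex (Code × List ℕ)`, so sorting and minima agree definitionally);
* `frameL`, `cfgL` — the translation of frames; `classifyL_eq`, **`stepL_cfgL`** (one list
  transition on a translated configuration is the translation of one transition) and
  **`runL_cfgL`**;
* **`runL_root`** — from the translated root frame, `5 · 2^(14k+1)` list transitions end in the
  translation of `[ret (canonOrd R G col)]` (`run_classify_of_le`, `cost_root_le_two_pow`).

## References

* B. Laubner, PhD thesis, HU Berlin 2011, doi:10.18452/16335, §3.4. [Laubner2011]
* D. G. Corneil, M. K. Goldberg, J. Algorithms 5 (1984) 345–362. [CorneilGoldberg1984]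
-/

namespace Literature.Computability.Complexity

open Literature.Combinatorics.SimpleGraph Finset ColourRefinementScheme CGCanon

open scoped Classical

noncomputable section

namespace CGProg

variable {k : ℕ}

/-! ### List frames -/

/-- Candidates on lists: code, branching vertex, ordering. [folklore] -/
abbrev LCand : Type := Lex (Code × Lex (ℕ × List ℕ))

/-- **List frames**: the frames of `CGCanon.Frame` with masks for subsets, colour lists for
colourings and numerals for vertices. [cite: Laubner2011, §3.4] -/
inductive LFrame : Type
  | indiv : List Bool → List ℕ → Option ℕ → List ℕ → Option LCand → LFrame
  | sect : List Bool → List ℕ → Option (List Bool) → List (List Bool) → List (List Bool × List ℕ) → LFrame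
  | ret : List ℕ → LFrame

variable (n : ℕ) (A : List (List Bool))

/-- Membership in the branching cell, on lists: a non-singleton cell of least (size, colour). [cite: Laubner2011, §3.4 step 3] -/
def inBigMinCellL (mask : List Bool) (col : List ℕ) (v : ℕ) : Bool :=
  let csize : ℕ → ℕ := fun w => ((wlistL mask).filter fun u => decide (natAt col u = natAt col w)).length
  bitAt mask v && decide (2 ≤ csize v) &&
    (wlistL mask).all fun w => !decide (2 ≤ csize w) || decide (toLex (csize v, natAt col v) ≤ toLex (csize w, natAt col w))

/-- The branching cell as a sorted vertex list. [folklore] -/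
def bigMinCellL (mask : List Bool) (col : List ℕ) : List ℕ := (wlistL mask).filter (inBigMinCellL mask col)

/-- **The starting list frame of a state.** [cite: Laubner2011, §3.4 steps 1–3] -/
def classifyL (mask : List Bool) (col : List ℕ) : LFrame :=
  if (wlistL mask).length ≤ 1 then LFrame.ret (wlistL mask)
  else if isConnL n A mask col then
    (if bigMinCellL mask col ≠ [] then LFrame.indiv mask col none (bigMinCellL mask col) none
     else LFrame.ret (wlistL mask))
  else LFrame.sect mask col none (partsL n A mask col) []

/-- Keeping the least candidate. [folklore] -/
def bestOfL (o : Option LCand) (b : LCand) : Option LCand := some (o.elim b fun a => min a b)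

/-- The key of a finished part on lists. [folklore] -/
def pkeyL (col : List ℕ) (p : List Bool × List ℕ) : Lex (Code × List ℕ) := toLex (toLex (codeL A col p.2), wlistL p.1)

/-- Pasting finished parts on lists. [cite: Laubner2011, Thm. 3.4.3] -/
def pasteL (col : List ℕ) (done : List (List Bool × List ℕ)) : List ℕ :=
  (done.insertionSort fun a b => pkeyL A col a ≤ pkeyL A col b).flatMap Prod.snd

/-- **One list transition.** [cite: Laubner2011, §3.4] -/
def stepL : List LFrame → List LFrame
  | LFrame.ret ord :: LFrame.indiv mask col (some x) xs best :: stk =>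
      LFrame.indiv mask col none xs (bestOfL best (toLex (toLex (codeL A col ord), toLex (x, ord)))) :: stk
  | LFrame.ret ord :: LFrame.sect mask col (some K) todo done :: stk => LFrame.sect mask col none todo (done ++ [(K, ord)]) :: stk
  | LFrame.indiv mask col _ (x :: xs) best :: stk =>
      classifyL n A mask (refineL n A mask (individualizeL col x)) :: LFrame.indiv mask col (some x) xs best :: stk
  | LFrame.indiv _ _ _ [] best :: stk => LFrame.ret (best.elim [] fun b => (ofLex (ofLex b).2).2) :: stk
  | LFrame.sect mask col _ (K :: todo) done :: stk => classifyL n A K col :: LFrame.sect mask col (some K) todo done :: stk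
  | LFrame.sect _ col _ [] done :: stk => LFrame.ret (pasteL A col done) :: stk
  | cfg => cfg

/-- `m` list transitions. [folklore] -/
def runL (m : ℕ) (cfg : List LFrame) : List LFrame := (stepL n A)^[m] cfg

/-! ### Translating frames -/

/-- A candidate on lists. [folklore] -/
def candL (b : Cand k) : LCand := toLex ((ofLex b).1, toLex ((ofLex (ofLex b).2).1, (ofLex (ofLex b).2).2.map Fin.val))

/-- A frame on lists. [folklore] -/
def frameL : Frame k → LFrame
  | Frame.indiv W c cur xs best => LFrame.indiv (maskOf W) (colOf c) (cur.map Fin.val) (xs.map Fin.val) (best.map candL)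
  | Frame.sect W c cur todo done => LFrame.sect (maskOf W) (colOf c) (cur.map maskOf) (todo.map maskOf) (done.map fun p => (maskOf p.1, p.2.map Fin.val))
  | Frame.ret ord => LFrame.ret (ord.map Fin.val)

/-- A configuration on lists. [folklore] -/
def cfgL (cfg : List (Frame k)) : List LFrame := cfg.map frameL

variable {n A} (G : SimpleGraph (Fin k))

/-! ### Agreement of the ingredients -/

/-- Lexicographic comparison of vertex lists is preserved by `Fin.val`. [folklore] -/
theorem map_val_lt_iff {l₁ l₂ : List (Fin k)} : l₁.map Fin.val < l₂.map Fin.val ↔ l₁ < l₂ := by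
  induction l₁ generalizing l₂ with
  | nil => cases l₂ <;> simp
  | cons a l₁ ih =>
    cases l₂ with
    | nil => simp
    | cons b l₂ =>
      rw [List.map_cons, List.map_cons, List.cons_lt_cons_iff, List.cons_lt_cons_iff, ih, Fin.lt_def, Fin.val_inj]

/-- Hence `≤` too. [folklore] -/
theorem map_val_le_iff {l₁ l₂ : List (Fin k)} : l₁.map Fin.val ≤ l₂.map Fin.val ↔ l₁ ≤ l₂ := by
  rw [← not_lt, ← not_lt, map_val_lt_iff]

/-- `candL` is strictly monotone. [folklore] -/
theorem candL_lt_iff {a b : Cand k} : candL a < candL b ↔ a < b := by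
  obtain ⟨A, N, L⟩ := a
  obtain ⟨A', N', L'⟩ := b
  show toLex (A, toLex (N, L.map Fin.val)) < toLex (A', toLex (N', L'.map Fin.val)) ↔ toLex (A, toLex (N, L)) < toLex (A', toLex (N', L'))
  simp only [Prod.Lex.toLex_lt_toLex, map_val_lt_iff]

/-- `candL` commutes with `min`. [folklore] -/
theorem candL_min (a b : Cand k) : candL (min a b) = min (candL a) (candL b) := by
  rcases lt_trichotomy a b with h | rfl | h
  · rw [min_eq_left h.le, min_eq_left (candL_lt_iff.2 h).le]
  · rw [min_self, min_self]
  · rw [min_eq_right h.le, min_eq_right (candL_lt_iff.2 h).le]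

/-- `bestOfL` translates `bestOf`. [folklore] -/
theorem bestOfL_map (o : Option (Cand k)) (b : Cand k) : bestOfL (o.map candL) (candL b) = (bestOf o b).map candL := by
  cases o <;> simp [bestOfL, bestOf, candL_min]

variable (W : Finset (Fin k)) (c : Fin k → ℕ)

/-- A filter of the sorted vertex list is the sorted sub-finset. [folklore] -/
theorem filter_wlistL_eq (q : ℕ → Bool) (S : Finset (Fin k)) (hS : S ⊆ W) (hq : ∀ v : Fin k, v ∈ W → (q v = true ↔ v ∈ S)) :
    (wlistL (maskOf W)).filter q = (S.sort (· ≤ ·)).map Fin.val := by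
  rw [wlistL_eq, List.filter_map]
  congr 1
  have h₁ : ((W.sort (· ≤ ·)).filter (q ∘ Fin.val)).SortedLT :=
    List.sortedLT_iff_pairwise.2 ((W.sortedLT_sort).pairwise.filter _)
  refine h₁.eq_of_mem_iff (S.sortedLT_sort) fun v => ?_
  simp only [List.mem_filter, mem_sort, Function.comp_apply]
  exact ⟨fun ⟨hv, hqv⟩ => (hq v hv).1 hqv, fun hv => ⟨hS hv, (hq v (hS hv)).2 hv⟩⟩

/-- Cell sizes on lists. [folklore] -/
theorem csize_eq (w : Fin k) :
    ((wlistL (maskOf W)).filter fun u => decide (natAt (colOf c) u = natAt (colOf c) w)).length = (cell W c w).card := by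
  rw [filter_wlistL_eq W _ (cell W c w) (cell_subset W c w) fun v hv => by simp [natAt_colOf, mem_cell, hv], List.length_map, length_sort]

/-- Membership in the branching cell on lists. [folklore] -/
theorem inBigMinCellL_eq (v : Fin k) : inBigMinCellL (maskOf W) (colOf c) v = decide (v ∈ bigMinCell W c) := by
  rw [Bool.eq_iff_iff, decide_eq_true_iff, mem_bigMinCell]
  unfold inBigMinCellL cellKey
  simp only [csize_eq W c v]
  simp only [Bool.and_eq_true, decide_eq_true_iff, bitAt_maskOf, List.all_eq_true, Bool.or_eq_true, Bool.not_eq_true',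
    decide_eq_false_iff_not]
  rw [natAt_colOf]
  have hmem : ∀ w : Fin k, w.val ∈ wlistL (maskOf W) ↔ w ∈ W := fun w => by
    rw [wlistL_eq, List.mem_map]
    exact ⟨fun ⟨w', hw', h⟩ => Fin.val_injective h ▸ (by simpa using hw'), fun hw => ⟨w, by simpa using hw, rfl⟩⟩
  constructor
  · rintro ⟨⟨hv, h2⟩, h⟩
    refine ⟨hv, h2, fun w hw hw2 => ?_⟩
    have := h w.val ((hmem w).2 hw)
    rw [csize_eq W c w, natAt_colOf] at this
    exact this.resolve_left (not_not.2 hw2)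
  · rintro ⟨hv, h2, h⟩
    refine ⟨⟨hv, h2⟩, fun x hx => ?_⟩
    have hxk : x < k := by
      rw [wlistL_eq] at hx
      obtain ⟨w, -, rfl⟩ := List.mem_map.1 hx
      exact w.isLt
    have hw : (⟨x, hxk⟩ : Fin k) ∈ W := (hmem ⟨x, hxk⟩).1 hx
    rw [show x = (⟨x, hxk⟩ : Fin k).val from rfl, csize_eq W c ⟨x, hxk⟩, natAt_colOf]
    by_cases hw2 : 2 ≤ (cell W c ⟨x, hxk⟩).card
    · exact Or.inr (h _ hw hw2)
    · exact Or.inl hw2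

/-- The branching cell on lists is the sorted branching cell. [folklore] -/
theorem bigMinCellL_eq : bigMinCellL (maskOf W) (colOf c) = ((bigMinCell W c).sort (· ≤ ·)).map Fin.val :=
  filter_wlistL_eq W _ _ (filter_subset _ W) fun v _ => by rw [inBigMinCellL_eq, decide_eq_true_iff]

/-- The parts on lists are the translated machine enumeration. [folklore] -/
theorem partsL_eq : partsL k (adjOf G) (maskOf W) (colOf c) = (partsList G W c).map maskOf := by
  unfold partsL partsList
  rw [wlistL_eq, List.map_map, show compMaskL k (adjOf G) (maskOf W) (colOf c) ∘ Fin.val = maskOf ∘ comp G W c from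
    funext fun u => compMaskL_eq G W c u, ← List.map_map, List.dedup_map_of_injective maskOf_injective]

/-- **The starting frames agree.** [folklore] -/
theorem classifyL_eq : classifyL k (adjOf G) (maskOf W) (colOf c) = frameL (classify G W c) := by
  unfold classifyL classify
  have hlen : (wlistL (maskOf W)).length = W.card := by rw [wlistL_eq, List.length_map, length_sort]
  have hne : (bigMinCellL (maskOf W) (colOf c) ≠ []) ↔ (bigMinCell W c).Nonempty := by
    rw [bigMinCellL_eq, Ne, List.map_eq_nil_iff]
    constructor
    · intro h
      by_contra h'
      rw [not_nonempty_iff_eq_empty] at h'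
      exact h (by rw [h']; simp)
    · rintro ⟨x, hx⟩ h
      have : x ∈ (bigMinCell W c).sort (· ≤ ·) := by simpa using hx
      rw [h] at this
      exact List.not_mem_nil this
  rw [hlen, isConnL_eq, wlistL_eq, bigMinCellL_eq, partsL_eq]
  by_cases h1 : W.card ≤ 1
  · rw [if_pos h1, if_pos h1]; rfl
  rw [if_neg h1, if_neg h1]
  by_cases h2 : IsConn G W c
  · rw [decide_eq_true h2, if_pos rfl, if_pos h2]
    by_cases h3 : (bigMinCell W c).Nonempty
    · rw [if_pos (by rwa [← bigMinCellL_eq, hne]), if_pos h3]; rfl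
    · rw [if_neg (by rwa [← bigMinCellL_eq, hne]), if_neg h3]; rfl
  · rw [decide_eq_false h2, if_neg (by simp), if_neg h2]; rfl

/-- The keys of finished parts agree. [folklore] -/
theorem pkeyL_eq (p : Finset (Fin k) × List (Fin k)) : pkeyL (adjOf G) (colOf c) (maskOf p.1, p.2.map Fin.val) = pkey G c p := by
  unfold pkeyL pkey
  rw [codeL_eq, toLex_ofLex, wlistL_eq]

/-- Pasting agrees. [folklore] -/
theorem pasteL_eq (done : List (Finset (Fin k) × List (Fin k))) :
    pasteL (adjOf G) (colOf c) (done.map fun p => (maskOf p.1, p.2.map Fin.val)) = (pasteM G c done).map Fin.val := by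
  unfold pasteL pasteM
  rw [← List.map_insertionSort (r := fun a b => pkey G c a ≤ pkey G c b)
      (s := fun a b => pkeyL (adjOf G) (colOf c) a ≤ pkeyL (adjOf G) (colOf c) b)
      (f := fun p : Finset (Fin k) × List (Fin k) => (maskOf p.1, p.2.map Fin.val)) (l := done)
      (hl := fun a _ b _ => by simp only [pkeyL_eq]),
    List.flatMap_map, List.map_flatMap]

/-! ### One transition commutes with the translation -/

/-- **A list transition on a translated configuration is the translated transition**
(refiner: ordered colour refinement). [folklore] -/
theorem stepL_cfgL (cfg : List (Frame k)) : stepL k (adjOf G) (cfgL cfg) = cfgL (step (crRefiner k) G cfg) := by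
  rcases cfg with _ | ⟨f, cfg⟩
  · rfl
  rcases f with ⟨W, c, cur, xs, best⟩ | ⟨W, c, cur, todo, done⟩ | ord
  · -- individualization frame on top
    rcases xs with _ | ⟨x, xs⟩
    · cases best <;> rfl
    · show classifyL k (adjOf G) (maskOf W) (refineL k (adjOf G) (maskOf W) (individualizeL (colOf c) x.val)) ::
          LFrame.indiv (maskOf W) (colOf c) (some x.val) (xs.map Fin.val) (best.map candL) :: cfgL cfg = _
      rw [individualizeL_colOf, refineL_eq, classifyL_eq]
      cases cur <;> rfl
  · -- section frame on top
    rcases todo with _ | ⟨K, todo⟩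
    · show LFrame.ret (pasteL (adjOf G) (colOf c) (done.map fun p => (maskOf p.1, p.2.map Fin.val))) :: cfgL cfg = _
      rw [pasteL_eq]; rfl
    · show classifyL k (adjOf G) (maskOf K) (colOf c) :: LFrame.sect (maskOf W) (colOf c) (some (maskOf K)) (todo.map maskOf)
          (done.map fun p => (maskOf p.1, p.2.map Fin.val)) :: cfgL cfg = _
      rw [classifyL_eq]; cases cur <;> rfl
  · -- a finished child on top: deliver to the parent
    rcases cfg with _ | ⟨g, cfg⟩
    · rfl
    rcases g with ⟨W, c, cur, xs, best⟩ | ⟨W, c, cur, todo, done⟩ | ord'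
    · rcases cur with _ | x
      · rfl
      · show LFrame.indiv (maskOf W) (colOf c) none (xs.map Fin.val)
            (bestOfL (best.map candL) (toLex (toLex (codeL (adjOf G) (colOf c) (ord.map Fin.val)), toLex (x.val, ord.map Fin.val)))) :: cfgL cfg = _
        rw [codeL_eq, toLex_ofLex, show (toLex (code G c ord, toLex (x.val, ord.map Fin.val)) : LCand) =
          candL (toLex (code G c ord, toLex (x.val, ord))) from rfl, bestOfL_map]
        rfl
    · rcases cur with _ | K
      · rfl
      · show LFrame.sect (maskOf W) (colOf c) none (todo.map maskOf) ((done.map fun p => (maskOf p.1, p.2.map Fin.val)) ++ [(maskOf K, ord.map Fin.val)]) :: cfgL cfg = _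
        simp [cfgL, frameL, step]
    · rfl

/-- **Runs commute with the translation.** [folklore] -/
theorem runL_cfgL (m : ℕ) (cfg : List (Frame k)) : runL k (adjOf G) m (cfgL cfg) = cfgL (run (crRefiner k) G m cfg) := by
  induction m generalizing cfg with
  | zero => rfl
  | succ m ih =>
    unfold runL run at *
    rw [Function.iterate_succ_apply, Function.iterate_succ_apply, stepL_cfgL, ih]

/-- **The root run on lists**: from the starting frame of the refined root state, `5 · 2^(14k+1)`
list transitions end in the translated canonical ordering. [cite: Laubner2011, §3.4–3.5] -/
theorem runL_root (G : SimpleGraph (Fin k)) (col : Fin k → ℕ) :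
    runL k (adjOf G) (5 * 2 ^ (14 * k + 1))
      [classifyL k (adjOf G) (maskOf (univ : Finset (Fin k))) (refineL k (adjOf G) (maskOf (univ : Finset (Fin k))) (colOf col))] =
      [LFrame.ret ((canonOrd (crRefiner k) G col).map Fin.val)] := by
  rw [refineL_eq, classifyL_eq, show [frameL (classify G univ (crRefine G univ col))] = cfgL [classify G univ ((crRefiner k).refine G univ col)] from rfl,
    runL_cfgL, run_classify_of_le _ _ _ _ (Nat.mul_le_mul_left 5 (cost_root_le_two_pow (crRefiner k) G col))]
  rfl

end CGProg

end

end Literature.Computability.Complexity
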